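import Summits.ResolutionOfSingularities.ResolutionOfSingularities.Theorems.EquisingularLiftEquisingularLiftNatNosePointsFirst
import Summits.ResolutionOfSingularities.ResolutionOfSingularities.Theorems.EquisingularLiftEquisingularLiftNatNoseResidueCurveAtoms
import Summits.ResolutionOfSingularities.ResolutionOfSingularities.Theorems.EquisingularLiftEquisingularLiftNatTowerFrameSupply
import Literature.AlgebraicGeometry.Resolution.AlterationsResolution
import Literature.AlgebraicGeometry.Resolution.NormalCrossingsStrictification
import Literature.AlgebraicGeometry.Morphisms.ProperGenericFibreDim
import HarnessLib

/-!
# [OURS · L1 W4.5(b) · EL♮(3)] NOSE RESIDUE STRUCTURE, brick 9 — the STRICT TRANSFORM of a singular curve under the points-first prefix is again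
# an infinite curve with one-dimensional local rings (NOSE WORD v1 §3 row 1 (a), generically)

Cell `res-hironaka`, rung L, slot W4.5(b), D-0157 DOOR 1 width seat `res-L1-w45b-nose-w4` (RULING R33 (δ) NOSE WORD v1; §5 ask «nose-w4: (a) of §3 row 1
generically — the strict transform of a singular curve under the ✓ p646582 prefix is infinite with the curve clause»); crux CHILD EL♮(3) =
stmt-ResolutionOfSingularities-20148 (parent EL♮ stmt-…-20038). OURS; NOT a statement of any manuscript; nothing of [Hironaka2017] is asserted or used;
AI kernel work, weaker than expert review. Resolution of singularities in positive characteristic is NOT proved here (dimension 3 is a theorem in print,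
Cossart–Piltant 2008/2009). No `sorry`, no new definition, no instance, no notation; standard axioms.
`--kind proof --supports stmt-ResolutionOfSingularities-20148 --as helper`.  Sister files: bricks 1–8 (`…NatNoseResidueUnfold` … `…NatNoseResidueSingularCurvesCanonical`),
res-L1-w45b-nose-w2's ✓ p646582 `…NatNosePointsFirst`.

* §1 `ringKrullDim_stalk_eq_one_of_isClosed_of_infinite` — FIELD-FREE curve clause: an integral locally Noetherian scheme `C` with `topologicalKrullDim C ≤ 1`
  and infinitely many points has `dim 𝒪_{C,c} = 1` at every CLOSED point `c` (`c` is not the generic point; `1 ≤ dim 𝒪_{C,c}` by Literature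
  `one_le_ringKrullDim_stalk_of_ne_genericPoint`, `dim 𝒪_{C,c} ≤ dim C` by `ringKrullDim_stalk_le_topologicalKrullDim`).
* §2 `curveClause_redSub_range_of_isClosedImmersion` — transport to the ambient: for a closed immersion `i : C ↪ F` of such a `C`, the reduced closed subscheme
  `redSub F (range i)` is canonically isomorphic to `C` (`ker_redSubι_range_eq`/`isIso_lift_redSub_range`: `ker_eq_vanishingIdeal_range` + `IsClosedImmersion.isIso_lift`), so it satisfies the curve clause
  `∀ z, IsClosed {z} → ringKrullDim 𝒪 = 1`; and `range i` is closed, irreducible and infinite (`noseData_range_of_isClosedImmersion`).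
* §3 `infinite_of_isBirational_of_isProper` — a proper birational `C' → C` onto an infinite scheme has an infinite source (it is surjective: dominant by Literature
  `IsBirational.isDominant` with closed image).
* §4 ★ `strictTransform_singularCurve_noseData` — plugged into the OUTPUT of ✓ p646582 `exists_pointSteps_regularise_curve`/`…_singularCurve`
  (`i' : C' ↪ F'` closed immersion, `C'` integral, `ρC : C' → C` proper birational, `dim C' ≤ 1`, `C` an infinite integral Noetherian curve): the strict transform
  `Z' = range i'` is CLOSED, IRREDUCIBLE, INFINITE and its reduced subscheme has `dim 𝒪 = 1` at closed points — i.e. every nose-data clause of the B″/B‴ engines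
  one floor up, except the lift certificate (class₂ / `H¹(𝒩) = 0`), which is the word's named question.
* §5 ★ `exists_pointSteps_regularise_singularCurve_noseData_three` — the ℙ³ instance for a singular curve `Z` of a residue `H` (bricks 2/6 supply the inputs
  `IsIntegral`/`IsNoetherian`/quasi-excellent/`dim ≤ 1` of `Z̃`): nose-w2's points-first conclusion AND the strict transform's nose data, in one statement.
-/

set_option linter.dupNamespace false

noncomputable section

open CategoryTheory CategoryTheory.Limits AlgebraicGeometry TopologicalSpace Topology IsLocalRing
open Literature.AlgebraicGeometry.Resolution
open Literature.AlgebraicGeometry.Morphisms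
open Literature.AlgebraicGeometry.Motives
open AlgebraicGeometry.Scheme.IdealSheafData
open Summit.ResolutionOfSingularities.ResolutionOfSingularities.Cruxes.EquisingularLift.StrataSplit

namespace Summit.ResolutionOfSingularities.ResolutionOfSingularities.Cruxes.EquisingularLiftNat.Sections

/-! ## §1 The field-free curve clause -/

/-- A closed point of an irreducible scheme with infinitely many points is not the generic point. [folklore] -/
theorem ne_genericPoint_of_isClosed_of_infinite {C : Scheme.{0}} [IrreducibleSpace C] (hinf : Infinite C) {c : C}
    (hc : IsClosed ({c} : Set C)) : c ≠ genericPoint C := by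
  intro h
  have huniv : ({c} : Set C) = Set.univ := by
    rw [← hc.closure_eq, h]
    exact (genericPoint_spec C).def
  have : Subsingleton C := ⟨fun a b => by
    have ha : a ∈ ({c} : Set C) := huniv ▸ Set.mem_univ a
    have hb : b ∈ ({c} : Set C) := huniv ▸ Set.mem_univ b
    rw [Set.mem_singleton_iff.mp ha, Set.mem_singleton_iff.mp hb]⟩
  exact not_finite C

/-- **FIELD-FREE CURVE CLAUSE.** An integral locally Noetherian scheme `C` of topological Krull dimension `≤ 1` with infinitely many points has
`dim 𝒪_{C,c} = 1` at every CLOSED point `c`. [cite: StacksProject, Tag 02IZ] [folklore] -/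
theorem ringKrullDim_stalk_eq_one_of_isClosed_of_infinite {C : Scheme.{0}} [IsIntegral C] [IsLocallyNoetherian C]
    (hdim : topologicalKrullDim C ≤ 1) (hinf : Infinite C) (c : C) (hc : IsClosed ({c} : Set C)) :
    ringKrullDim (C.presheaf.stalk c) = ((1 : ℕ) : WithBot ℕ∞) := by
  have hne : c ≠ genericPoint C := ne_genericPoint_of_isClosed_of_infinite hinf hc
  have h1 : (1 : WithBot ℕ∞) ≤ ringKrullDim (C.presheaf.stalk c) := one_le_ringKrullDim_stalk_of_ne_genericPoint c hne
  have h2 : ringKrullDim (C.presheaf.stalk c) ≤ 1 := (ringKrullDim_stalk_le_topologicalKrullDim C c).trans hdim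
  exact_mod_cast le_antisymm h2 h1

/-! ## §2 Transport to the reduced image of a closed immersion -/

/-- The kernel of the reduced closed subscheme on the image of a closed immersion `i` from a REDUCED scheme is the kernel of `i`. [folklore] -/
theorem ker_redSubι_range_eq {C F : Scheme.{0}} (i : C ⟶ F) [IsClosedImmersion i] [IsReduced C] (hZ : IsClosed (Set.range i)) :
    (redSubι F (Set.range i) hZ).ker = i.ker := by
  rw [Scheme.IdealSheafData.ker_subschemeι, ker_eq_vanishingIdeal_range i hZ]

/-- The comparison morphism `C ⟶ redSub F (range i)` of a closed immersion `i` from a REDUCED scheme is an isomorphism. [folklore] -/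
theorem isIso_lift_redSub_range {C F : Scheme.{0}} (i : C ⟶ F) [IsClosedImmersion i] [IsReduced C] (hZ : IsClosed (Set.range i)) :
    IsIso (IsClosedImmersion.lift (redSubι F (Set.range i) hZ) i (ker_redSubι_range_eq i hZ).le) :=
  IsClosedImmersion.isIso_lift _ i (ker_redSubι_range_eq i hZ)

/-- **Curve clause for the reduced image of a closed immersion.** For a closed immersion `i : C ↪ F` of an integral locally Noetherian scheme `C` with
`topologicalKrullDim C ≤ 1` and infinitely many points, the reduced closed subscheme of `F` on `range i` has `dim 𝒪 = 1` at every closed point.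
[folklore] -/
theorem curveClause_redSub_range_of_isClosedImmersion {C F : Scheme.{0}} (i : C ⟶ F) [IsClosedImmersion i] [IsIntegral C] [IsLocallyNoetherian C]
    (hdim : topologicalKrullDim C ≤ 1) (hinf : Infinite C) (hZ : IsClosed (Set.range i)) :
    ∀ z : ↥(redSub F (Set.range i) hZ), IsClosed ({z} : Set ↥(redSub F (Set.range i) hZ)) →
      ringKrullDim ((redSub F (Set.range i) hZ).presheaf.stalk z) = ((1 : ℕ) : WithBot ℕ∞) := by
  haveI := isIso_lift_redSub_range i hZ
  intro z hz
  exact ringKrullDim_stalk_eq_of_isIso (inv (IsClosedImmersion.lift (redSubι F (Set.range i) hZ) i (ker_redSubι_range_eq i hZ).le))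
    (fun c hc => ringKrullDim_stalk_eq_one_of_isClosed_of_infinite hdim hinf c hc) z hz

/-- The image of a closed immersion of an irreducible scheme with infinitely many points is closed, irreducible and infinite. [folklore] -/
theorem noseData_range_of_isClosedImmersion {C F : Scheme.{0}} (i : C ⟶ F) [IsClosedImmersion i] [IrreducibleSpace C] (hinf : Infinite C) :
    IsClosed (Set.range i) ∧ IsIrreducible (Set.range i) ∧ (Set.range i).Infinite := by
  refine ⟨i.isClosedEmbedding.isClosed_range, ?_, Set.infinite_range_of_injective i.isClosedEmbedding.injective⟩
  rw [← Set.image_univ]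
  exact (IrreducibleSpace.isIrreducible_univ C).image _ i.continuous.continuousOn

/-! ## §3 Proper birational maps onto infinite curves have infinite sources -/

/-- A proper birational morphism onto a scheme with infinitely many points has a source with infinitely many points (it is surjective). [folklore] -/
theorem infinite_of_isBirational_of_isProper {C' C : Scheme.{0}} (ρ : C' ⟶ C) [IsProper ρ] (hρ : IsBirational ρ) (hinf : Infinite C) :
    Infinite C' := by
  have hd : DenseRange ρ := (IsBirational.isDominant hρ).denseRange
  have hc : IsClosed (Set.range ρ) := ρ.isClosedMap.isClosed_range
  have hsurj : Function.Surjective ρ := by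
    rw [← Set.range_eq_univ, ← hc.closure_eq, hd.closure_range]
  exact Infinite.of_surjective ρ hsurj

/-! ## §4 The strict transform of a singular curve under the points-first prefix -/

/-- **THE STRICT TRANSFORM CARRIES THE NOSE DATA** (NOSE WORD v1 §3 row 1 (a), generically).  In the output of res-L1-w45b-nose-w2's
`exists_pointSteps_regularise_curve` (✓ p646582) — `i' : C' ↪ F'` a closed immersion of an INTEGRAL scheme with `topologicalKrullDim C' ≤ 1`, `ρC : C' → C`
PROPER and BIRATIONAL onto an integral Noetherian scheme `C` with infinitely many points — the strict transform `Z' := range i'` is closed, irreducible and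
INFINITE, and its reduced subscheme `redSub F' Z'` has `dim 𝒪 = 1` at every closed point.  (The lift certificate of `Z'` — class₂ in `ℙⁿ` or `H¹(𝒩) = 0` at
the stage — is NOT addressed: that is the word's named question.) [folklore] -/
theorem strictTransform_singularCurve_noseData {C C' F' : Scheme.{0}} (i' : C' ⟶ F') [IsClosedImmersion i'] [IsIntegral C']
    (ρC : C' ⟶ C) [IsProper ρC] (hbir : IsBirational ρC) [IsIntegral C] [IsNoetherian C] (hCinf : Infinite C)
    (hdim' : topologicalKrullDim C' ≤ 1) :
    ∃ hZ' : IsClosed (Set.range i'), IsIrreducible (Set.range i') ∧ (Set.range i').Infinite ∧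
      ∀ z : ↥(redSub F' (Set.range i') hZ'), IsClosed ({z} : Set ↥(redSub F' (Set.range i') hZ')) →
        ringKrullDim ((redSub F' (Set.range i') hZ').presheaf.stalk z) = ((1 : ℕ) : WithBot ℕ∞) := by
  haveI : IsLocallyNoetherian C' := LocallyOfFiniteType.isLocallyNoetherian ρC
  have hinf' : Infinite C' := infinite_of_isBirational_of_isProper ρC hbir hCinf
  obtain ⟨hcl, hirr, hinf⟩ := noseData_range_of_isClosedImmersion i' hinf'
  exact ⟨hcl, hirr, hinf, curveClause_redSub_range_of_isClosedImmersion i' hdim' hinf' hcl⟩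

/-! ## §5 At `ℙ³_k`: points first on a singular curve of a residue `H`, with the strict transform's nose data -/

/-- The reduced subscheme of an infinite closed set has infinitely many points. [folklore] -/
theorem infinite_redSub_of_infinite {F : Scheme.{0}} {Z : Set F} (hZ : IsClosed Z) (hZinf : Z.Infinite) : Infinite ↥(redSub F Z hZ) := by
  have h : (Set.range (redSubι F Z hZ)).Infinite := by rw [range_subschemeι_vanishingIdeal]; exact hZinf
  rw [← Set.image_univ] at h
  exact Set.infinite_univ_iff.mp (Set.Infinite.of_image _ h)

/-- **POINTS FIRST ON A SINGULAR CURVE OF `H ⊂ ℙ³_k`, WITH THE STRICT TRANSFORM'S NOSE DATA** (nose-w2's ✓ p646582 `exists_pointSteps_regularise_singularCurve`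
fed with bricks 2/6 and completed by §4).  `ι : H ↪ ℙ³_k` a closed immersion of an integral non-regular scheme, `Z` a singular curve of `H` (closed, irreducible,
infinite, `Z ⊆ ι(Sing H)`, `ι(H) ⊄ Z`), `Q` any stage predicate closed under the chains' point step and holding at `(ℙ³, 𝟙, ι(H))`: finitely many point steps at
points over `Sing Z̃` reach a `Q`-stage `(F, π, T)` with `F` regular, `T` closed, and a closed immersion `i' : C' ↪ F` of a REGULAR integral curve, proper
birational over `Z̃`, with `i'(C') ⊆ T`, `T ⊄ i'(C')`, every point of `i'(C')` non-regular on `T̂`, AND `i'(C')` closed, irreducible, INFINITE with the curve clause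
for its reduced subscheme.  Honest scope: the lift certificate of `i'(C')` is not addressed. [cite: Liu2002, §9.2.4 Lemma 2.32] [OURS · L1 W4.5b · nose residue (B2)] -/
theorem exists_pointSteps_regularise_singularCurve_noseData_three (k : Type) [Field k] (H : Scheme.{0})
    (ι : H ⟶ (projectiveSpace 3 k).left) [IsClosedImmersion ι] [IsIntegral H]
    (hH : ¬ Literature.AlgebraicGeometry.Resolution.Scheme.IsRegular H)
    (Q : ∀ F : Scheme.{0}, (F ⟶ (projectiveSpace 3 k).left) → Set F → Prop)
    (hQ : ∀ (F₁ F₂ : Scheme.{0}) (ρ : F₁ ⟶ (projectiveSpace 3 k).left) (T₁ : Set F₁)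
      (x : ↥(vanishingIdeal (⟨closure T₁, isClosed_closure⟩ : Closeds F₁)).subscheme) (υ : F₂ ⟶ F₁)
      (hx : IsClosed ({((vanishingIdeal (⟨closure T₁, isClosed_closure⟩ : Closeds F₁)).subschemeι x : F₁)} : Set F₁)),
      Q F₁ ρ T₁ →
      ¬ IsRegularLocalRing ((vanishingIdeal (⟨closure T₁, isClosed_closure⟩ : Closeds F₁)).subscheme.presheaf.stalk x) →
      IsRegularLocalRing (F₁.presheaf.stalk ((vanishingIdeal (⟨closure T₁, isClosed_closure⟩ : Closeds F₁)).subschemeι x : F₁)) →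
      IsBlowup υ (vanishingIdeal (⟨{((vanishingIdeal (⟨closure T₁, isClosed_closure⟩ : Closeds F₁)).subschemeι x : F₁)}, hx⟩ : Closeds F₁)) →
      Q F₂ (υ ≫ ρ) (closure (υ ⁻¹' (T₁ \ {((vanishingIdeal (⟨closure T₁, isClosed_closure⟩ : Closeds F₁)).subschemeι x : F₁)}))))
    (hQ0 : Q (projectiveSpace 3 k).left (𝟙 _) (Set.range ι))
    (Z : Set (projectiveSpace 3 k).left) (hZ : IsClosed Z) (hZirr : IsIrreducible Z) (hZinf : Z.Infinite)
    (hZsing : Z ⊆ ι '' {h : H | ¬ IsRegularLocalRing (H.presheaf.stalk h)}) (hPZ : ¬ Set.range ι ⊆ Z) :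
    ∃ (F C' : Scheme.{0}) (π : F ⟶ (projectiveSpace 3 k).left) (T : Set F) (i' : C' ⟶ F)
      (ρC : C' ⟶ redSub (projectiveSpace 3 k).left Z hZ),
      Q F π T ∧ IsLocallyNoetherian F ∧ Literature.AlgebraicGeometry.Resolution.Scheme.IsRegular F ∧ IsClosed T ∧
      IsPointBlowupComposition ((redSubι (projectiveSpace 3 k).left Z hZ) ''
        (Scheme.regularLocus (redSub (projectiveSpace 3 k).left Z hZ))ᶜ) π ∧
      IsClosedImmersion i' ∧ i' ≫ π = ρC ≫ redSubι (projectiveSpace 3 k).left Z hZ ∧ IsIntegral C' ∧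
      Literature.AlgebraicGeometry.Resolution.Scheme.IsRegular C' ∧
      IsProper ρC ∧ IsBirational ρC ∧ topologicalKrullDim C' ≤ 1 ∧ Set.range i' ⊆ T ∧ ¬ T ⊆ Set.range i' ∧
      (∀ z : ↥(vanishingIdeal (⟨closure T, isClosed_closure⟩ : Closeds F)).subscheme,
        ((vanishingIdeal (⟨closure T, isClosed_closure⟩ : Closeds F)).subschemeι z : F) ∈ Set.range i' →
        ¬ IsRegularLocalRing ((vanishingIdeal (⟨closure T, isClosed_closure⟩ : Closeds F)).subscheme.presheaf.stalk z)) ∧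
      ∃ hZ' : IsClosed (Set.range i'), IsIrreducible (Set.range i') ∧ (Set.range i').Infinite ∧
        ∀ z : ↥(redSub F (Set.range i') hZ'), IsClosed ({z} : Set ↥(redSub F (Set.range i') hZ')) →
          ringKrullDim ((redSub F (Set.range i') hZ').presheaf.stalk z) = ((1 : ℕ) : WithBot ℕ∞) := by
  -- the ambient `ℙ³_k`: regular, (locally) Noetherian
  haveI : IsNoetherian (projectiveSpace 3 k).left :=
    (isNoetherian_and_isQuasiExcellent_of_isClosedImmersion_projectiveSpace 3 (𝟙 (projectiveSpace 3 k).left)).1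
  have hP : Literature.AlgebraicGeometry.Resolution.Scheme.IsRegular (projectiveSpace 3 k).left := isRegular_projectiveSpace 3 k
  -- the singular curve `Z̃`: integral, Noetherian, quasi-excellent, one-dimensional, infinite (bricks 2/6)
  have hZsub : Z ⊆ Set.range ι := fun z hz => by obtain ⟨x, -, rfl⟩ := hZsing hz; exact Set.mem_range_self x
  obtain ⟨hint, hN, hqe, hdimZ⟩ := singularCurve_redSub_facts k H ι hH hZ hZirr hZinf hZsub hPZ
  haveI := hint
  haveI := hN
  have hZinf' : Infinite ↥(redSub (projectiveSpace 3 k).left Z hZ) := infinite_redSub_of_infinite hZ hZinf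
  obtain ⟨F, C', π, T, i', ρC, hQF, hFN, hFreg, hTcl, hpbc, hi', hcomm, hC'int, hC'reg, hprop, hbir, hdim', hsub, hnsub, hsing⟩ :=
    exists_pointSteps_regularise_singularCurve hP ι Q hQ hQ0 Z hZ hqe hdimZ.le hZsing hPZ
  haveI := hi'
  haveI := hC'int
  haveI := hprop
  exact ⟨F, C', π, T, i', ρC, hQF, hFN, hFreg, hTcl, hpbc, hi', hcomm, hC'int, hC'reg, hprop, hbir, hdim', hsub, hnsub, hsing,
    strictTransform_singularCurve_noseData i' ρC hbir hZinf' hdim'⟩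

end Summit.ResolutionOfSingularities.ResolutionOfSingularities.Cruxes.EquisingularLiftNat.Sections

end
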